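import Mathlib.NumberTheory.DiophantineApproximation.Basic
import Mathlib.Analysis.SpecialFunctions.Pow.Real
import HarnessLib

/-!
# Recovering an irrational period from two Fourier samples (Hallgren; Jozsa 2003, §10)

Topic `Computability/Cryptography`. Theorem-only file (no definitions, no named facts): the
classical post-processing of Hallgren's period finding over `ℝ`. After Fourier sampling in
dimension `q ≥ 3S²` one holds, with good probability, two characters `c = ⌊kq/S⌉`, `d = ⌊lq/S⌉`
near small multiples of `q/S` (`PseudoPeriodicCorrMass.lean`). Jozsa 2003, §10 (proof of Thm. 6,
p. 21 and Lemma 2):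

* **`abs_div_sub_div_lt`** (Lemma 2): if `1 ≤ k ≤ l ≤ S`, `q ≥ 3S²`, `|c − kq/S| ≤ 1/2`,
  `|d − lq/S| ≤ 1/2`, then `|c/d − k/l| < 1/(2l²)`; hence (`exists_convergent_eq`, Legendre's
  theorem `Real.exists_rat_eq_convergent`) `k/l` is a convergent of `c/d` when `gcd(k, l) = 1`
  ("we show that `k/l` is a convergent of the continued fraction of `c/d`, which then gives `k` as a
  numerator of a convergent");
* **`abs_mul_div_sub_lt`** ("the various rounding processes stay within the required accuracy"):
  `|kq/c − S| < 1/2` (indeed `≤ 1/5`), so that **`abs_round_sub_lt_one`**: the integer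
  `m = ⌊kq/c⌉` satisfies `|m − S| < 1`.

## References

* R. Jozsa, *Notes on Hallgren's efficient quantum algorithm for solving Pell's equation*,
  arXiv:quant-ph/0302134 (2003), §10 (proof of Thm. 6, p. 21; Lemma 2). [Jozsa2003]
* S. Hallgren, J. ACM 54 (2007), Art. 4, §3. [Hallgren2007]
-/

noncomputable section

namespace Literature.Computability.Cryptography

namespace Hallgren2007

/-- **Jozsa's Lemma 2**: two roundings `c, d` of `kq/S, lq/S` with `1 ≤ k ≤ l ≤ S` and `q ≥ 3S²`
have `|c/d − k/l| < 1/(2l²)`. [cite: Jozsa2003, §10 Lemma 2] -/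
theorem abs_div_sub_div_lt {S c d : ℝ} {q k l : ℕ} (hS : 1 ≤ S) (hq : 3 * S ^ 2 ≤ q)
    (hk : 1 ≤ k) (hkl : k ≤ l) (hlS : (l : ℝ) ≤ S)
    (hc : |c - k * q / S| ≤ 1 / 2) (hd : |d - l * q / S| ≤ 1 / 2) :
    |c / d - k / l| < 1 / (2 * (l : ℝ) ^ 2) := by
  have hS0 : 0 < S := by linarith
  have hk' : (1 : ℝ) ≤ k := by exact_mod_cast hk
  have hl' : (1 : ℝ) ≤ l := by exact_mod_cast (hk.trans hkl)
  have hkl' : (k : ℝ) ≤ l := by exact_mod_cast hkl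
  have hq' : 3 * S ^ 2 ≤ (q : ℝ) := hq
  set εk := c - k * q / S with hεk
  set εl := d - l * q / S with hεl
  have hεk' : |εk| ≤ 1 / 2 := hc
  have hεl' : |εl| ≤ 1 / 2 := hd
  obtain ⟨hεk1, hεk2⟩ := abs_le.mp hεk'
  obtain ⟨hεl1, hεl2⟩ := abs_le.mp hεl'
  have hcq : c = k * q / S + εk := by rw [hεk]; ring
  have hdq : d = l * q / S + εl := by rw [hεl]; ring
  -- `d > 0`
  have hlqS : (l : ℝ) * q / S ≥ 3 * S := by
    rw [ge_iff_le, le_div_iff₀ hS0]; nlinarith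
  have hd0 : 0 < d := by rw [hdq]; linarith
  have hl0 : (0 : ℝ) < l := by linarith
  -- the difference
  have key : c / d - k / l = (l * εk - k * εl) / (d * l) := by
    rw [div_sub_div _ _ hd0.ne' hl0.ne']
    congr 1
    rw [hcq, hdq]; ring
  rw [key, abs_div, abs_mul, abs_of_pos hd0, abs_of_pos hl0]
  have hnum : |(l : ℝ) * εk - k * εl| ≤ (l + k) / 2 := by
    calc |(l : ℝ) * εk - k * εl| ≤ |(l : ℝ) * εk| + |(k : ℝ) * εl| := abs_sub _ _
      _ = l * |εk| + k * |εl| := by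
          rw [abs_mul, abs_mul, abs_of_pos hl0, abs_of_pos (by linarith : (0 : ℝ) < k)]
      _ ≤ l * (1 / 2) + k * (1 / 2) := by gcongr
      _ = (l + k) / 2 := by ring
  have hden : (l : ℝ) * q / S - 1 / 2 ≤ d := by rw [hdq]; linarith
  have hden0 : 0 < (l : ℝ) * q / S - 1 / 2 := by linarith
  -- it suffices that `(l + k)/2 · 2l² < (lq/S − 1/2) · l`
  have hmain : (l + k) / 2 * (2 * (l : ℝ) ^ 2) < (l * q / S - 1 / 2) * l := by
    have e : ((l : ℝ) * q / S - 1 / 2) * l = (l * l * q - S * l / 2) / S := by field_simp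
    rw [e, lt_div_iff₀ hS0]
    have f1 : 3 * (l : ℝ) * S ^ 2 ≤ l * q := by
      have := mul_le_mul_of_nonneg_left hq' hl0.le; linarith
    have f2 : (l : ℝ) ^ 2 * S ≤ l * S ^ 2 := by
      have : 0 ≤ (l : ℝ) * S * (S - l) := mul_nonneg (mul_nonneg hl0.le hS0.le) (by linarith)
      linarith
    have f3 : 3 * (l : ℝ) ^ 3 * S ≤ l ^ 2 * q := by
      have h1 := mul_le_mul_of_nonneg_left f1 hl0.le
      have h2 := mul_le_mul_of_nonneg_left f2 (by positivity : (0 : ℝ) ≤ 3 * l)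
      linarith
    have f4 : ((l : ℝ) + k) * l ^ 2 * S ≤ 2 * l ^ 3 * S := by
      have : 0 ≤ ((l : ℝ) - k) * (l ^ 2 * S) := mul_nonneg (by linarith) (by positivity)
      linarith
    have f5 : S * (l : ℝ) / 2 < l ^ 3 * S := by
      have hl2 : (1 : ℝ) / 2 < l ^ 2 := by nlinarith
      have : 0 < S * l * (l ^ 2 - 1 / 2) := mul_pos (mul_pos hS0 hl0) (by linarith)
      linarith
    linarith [f3, f4, f5]
  rw [div_lt_div_iff₀ (by positivity) (by positivity)]
  calc |(l : ℝ) * εk - k * εl| * (2 * (l : ℝ) ^ 2) ≤ (l + k) / 2 * (2 * (l : ℝ) ^ 2) :=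
        mul_le_mul_of_nonneg_right hnum (by positivity)
    _ < (l * q / S - 1 / 2) * l := hmain
    _ ≤ d * l := mul_le_mul_of_nonneg_right hden hl0.le
    _ = 1 * (d * l) := (one_mul _).symm

/-- **`k/l` is a convergent of `c/d`** (Legendre's theorem applied to Lemma 2; `gcd(k,l) = 1`).
[cite: Jozsa2003, §10 (proof of Thm. 6: "k/l is a convergent of the continued fraction of c/d") with Lemma 2] -/
theorem exists_convergent_eq {S c d : ℝ} {q k l : ℕ} (hS : 1 ≤ S) (hq : 3 * S ^ 2 ≤ q)
    (hk : 1 ≤ k) (hkl : k ≤ l) (hlS : (l : ℝ) ≤ S) (hcop : Nat.Coprime k l)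
    (hc : |c - k * q / S| ≤ 1 / 2) (hd : |d - l * q / S| ≤ 1 / 2) :
    ∃ n : ℕ, (c / d).convergent n = (k : ℚ) / l := by
  have hl0 : 0 < l := hk.trans hkl
  have h := abs_div_sub_div_lt hS hq hk hkl hlS hc hd
  have hcop' : Nat.Coprime (k : ℤ).natAbs (l : ℤ).natAbs := by simpa using hcop
  have hl0' : (0 : ℤ) < l := by exact_mod_cast hl0
  have hden : ((((k : ℤ) : ℚ) / ((l : ℤ) : ℚ)).den : ℤ) = l := Rat.den_div_eq_of_coprime hl0' hcop'
  have hcast : ((k : ℤ) : ℚ) / ((l : ℤ) : ℚ) = (k : ℚ) / l := by push_cast; rfl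
  rw [hcast] at hden
  have hden' : (((k : ℚ) / l).den : ℝ) = l := by exact_mod_cast hden
  obtain ⟨n, hn⟩ := Real.exists_rat_eq_convergent (ξ := c / d) (q := (k : ℚ) / l) (by
    rw [hden']; push_cast; exact h)
  exact ⟨n, hn.symm⟩

/-- **The rounding `kq/c` recovers `S` to within `1/5`**: if `|c − kq/S| ≤ 1/2`, `k ≥ 1`, `S ≥ 1`,
`q ≥ 3S²` then `|kq/c − S| ≤ 1/5` (`kq/c = S/(1 + εS/(kq))`). [cite: Jozsa2003, §10 (proof of Thm. 6, p. 21: |S − ⌊kq/c⌉| ≤ 1)] -/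
theorem abs_mul_div_sub_le {S c : ℝ} {q k : ℕ} (hS : 1 ≤ S) (hq : 3 * S ^ 2 ≤ q) (hk : 1 ≤ k)
    (hc : |c - k * q / S| ≤ 1 / 2) : |k * q / c - S| ≤ 1 / 5 := by
  have hS0 : 0 < S := by linarith
  have hk' : (1 : ℝ) ≤ k := by exact_mod_cast hk
  have hq' : 3 * S ^ 2 ≤ (q : ℝ) := hq
  set ε := c - k * q / S with hε
  obtain ⟨hε1, hε2⟩ := abs_le.mp (show |ε| ≤ 1 / 2 from hc)
  have hcq : c = k * q / S + ε := by rw [hε]; ring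
  have hkq : (k : ℝ) * q ≥ 3 * S ^ 2 := by nlinarith
  have hc0 : 0 < c := by
    rw [hcq]
    have : (k : ℝ) * q / S ≥ 3 * S := by rw [ge_iff_le, le_div_iff₀ hS0]; nlinarith
    linarith
  have key : k * q / c - S = -(ε * S ^ 2) / (k * q + ε * S) := by
    have : c = (k * q + ε * S) / S := by rw [hcq]; field_simp
    rw [this]
    have hne : (k : ℝ) * q + ε * S ≠ 0 := by nlinarith
    field_simp
    ring
  rw [key, abs_div, abs_neg, abs_mul, abs_of_pos (by positivity : (0 : ℝ) < S ^ 2)]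
  have hden : (5 / 2) * S ^ 2 ≤ |(k : ℝ) * q + ε * S| := by
    rw [abs_of_pos (by nlinarith)]; nlinarith
  rw [div_le_iff₀ (by nlinarith)]
  have : |ε| ≤ 1 / 2 := hc
  nlinarith [abs_nonneg ε]

/-- **The recovered integer is within `1` of the period**: with `m = round (kq/c)`, `|m − S| < 1`.
[cite: Jozsa2003, §10 (proof of Thm. 6, p. 21: |S − ⌊kq/c⌉| ≤ 1)] -/
theorem abs_round_sub_lt_one {S c : ℝ} {q k : ℕ} (hS : 1 ≤ S) (hq : 3 * S ^ 2 ≤ q) (hk : 1 ≤ k)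
    (hc : |c - k * q / S| ≤ 1 / 2) : |(round ((k : ℝ) * q / c) : ℝ) - S| < 1 := by
  have h1 := abs_mul_div_sub_le hS hq hk hc
  have h2 := abs_sub_round ((k : ℝ) * q / c)
  calc |(round ((k : ℝ) * q / c) : ℝ) - S|
      = |((round ((k : ℝ) * q / c) : ℝ) - k * q / c) + (k * q / c - S)| := by ring_nf
    _ ≤ |(round ((k : ℝ) * q / c) : ℝ) - k * q / c| + |k * q / c - S| := abs_add_le _ _
    _ ≤ 1 / 2 + 1 / 5 := by rw [abs_sub_comm] at h2; exact add_le_add h2 h1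
    _ < 1 := by norm_num

end Hallgren2007

end Literature.Computability.Cryptography

end
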